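import Summits.CriticalPhenomena.PercolationContinuityZ3.Theorems.PercNearOneGluingNoHeavyLowerTailSahiC4CombBridge
import Summits.CriticalPhenomena.PercolationContinuityZ3.Theorems.PercNearOneGluingNoHeavyLowerTailSahiC3CubeLeThree

/-!
# `NoHeavyLowerTail` (crux stmt-CriticalPhenomena-4575): the kernel certificate of Sahi's `C₃` on small cubes, in COMB form —
# `checkTriple ⟹ CombPos`, hence (M⁺-3) and twisted three-partition positivity (★★) on every ground set of size `≤ 3`

Support file (cell `prim-l12`, seat P3, gen 2; `--supports stmt-CriticalPhenomena-4575`).  No `sorry`, no `native_decide`, standard axioms.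

prim-sahi P1's checker (`…SahiC3CubeCertCheck`: `checkTriple`, `checkCube`; soundness `checkTriple_sound`) certifies, by a digit test on
one Kronecker number, that ALL `4^m` three-copy fibre sums (`cubicCoef`, the degree-3 tensor-Bernstein coefficients of `E₃`) of a
triple of cube events are `≥ 0`; the landed statements drew only the LAW-level conclusion `E₃(μ_p) ≥ 0` (`sahiE3_nonneg_of_checkCube`,
`sahiC3_cube_le_three`, `sahiC3_cube_four`).  This file exposes the COMB-level content, in the vocabulary of the comb hierarchy
(`SahiComb.CombPos`, `MasterFamilyCombPos`) and of this seat's bridge (`ThreePartition.*`):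
* `cubicCoef_nonneg_of_checkTriple` — the digit test gives `cubicCoef ≥ 0` at every key (the first half of `checkTriple_sound`, verbatim);
* `sahiE_three_ind_eq_cubicForm`, `sahiE_three_ind_bernstein_cube` — `E₃(μ_p; 1_A,1_B,1_C)` on `Fin m` IS the cubic form, expanded in
  `bern (fun _ => 3) j`, `j ∈ box 3`, with coefficients `cubicCoef ∘ profKey3`;
* `combPos_sahiE_three_of_checkTriple`, `combPos_sahiE_three_of_checkCube` — a passing check is a `CombPos` certificate (symmetry of `E₃`
  handles the sorting in `checkCube`);
* `combPos_sahiE_three_cube_le_three` (from the `decide`-checked `checkCube_zero … checkCube_three`), and by relabelling transport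
  (`SahiC4CombBridge.CombPos.comp_equiv`, `sahiE_bernoulliWeight_comap_equiv`) **`combPos_sahiE_three_of_card_le_three`**: (M⁺-3) holds for
  every triple of increasing events on every ground set with `≤ 3` elements; hence (bridge, `ThreePartition.threePartNT_nonneg_of_combPos`)
  **`threePartNT_nonneg_of_card_le_three`**: (★★) on ground sets of size `≤ 3`, every twist.
The `m = 4` level (`checkCube_four`, `native_decide`) is in the computational companion `…SahiC3CombCubeFour`.
-/

noncomputable section

open scoped Classical

namespace Summit.CriticalPhenomena.PercolationContinuityZ3.Theorems

namespace SahiC3CombCube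

open Finset Function
open OneCutCert CovTransferCert SahiC3Cube SahiComb
open Literature.Combinatorics.Sahi2008
open Literature.Probability.LatticeModels (prodBernoulli sahiE3 sahiE3_def)
open Literature.Probability.Percolation.DecisionTree (ind ind_of_mem ind_of_not_mem ind_nonneg)

/-! ### The digit test certifies the fibre sums -/

/-- **`checkTriple` certifies every three-copy fibre sum** (`cubicCoef ≥ 0` at all keys).  The argument is the first half of
`SahiC3Cube.checkTriple_sound` (coefficient bound `6·8^m < 2^(σ−1)`, the certificate number is `cubicZ`, AND-mask digit test). [this work] -/
theorem cubicCoef_nonneg_of_checkTriple {σ m A B C : ℕ} (h : checkTriple σ m A B C = true) :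
    ∀ k, 0 ≤ cubicCoef sgn5 (X5 m A B C) (Y5 m A B C) (Z5 m C) k := by
  unfold checkTriple checkTripleW at h
  simp only [Bool.and_eq_true, decide_eq_true_eq] at h
  obtain ⟨⟨hσ, hbnd⟩, hZ, hland⟩ := h
  have hoff : offT σ m = (maskN σ (4 ^ m) : ℤ) := by
    unfold offT
    rw [off_eq σ (4 ^ m) hσ, maskN_eq_sum σ hσ, Finset.mul_sum]
  rw [hoff] at hZ hland
  rw [Int.toNat_natCast] at hland
  have hZeq : zE3 σ m (krT σ m (fullN m)) A B C = cubicZ (2 ^ σ) sgn5 (X5 m A B C) (Y5 m A B C) (Z5 m C) := by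
    unfold zE3 cubicZ
    simp only [Fin.sum_univ_five, sgn5, X5, Y5, Z5, Matrix.cons_val_zero, Matrix.cons_val_one, Matrix.cons_val,
      krT_eq]
    ring
  have hB : CoefBound3 sgn5 (X5 m A B C) (Y5 m A B C) (Z5 m C) (2 ^ (σ - 1)) := by
    intro k
    have hX : ∀ j g, |X5 m A B C j g| ≤ 1 := by intro j g; fin_cases j <;> exact abs_tabZ_le _ _ _
    have hY : ∀ j g, |Y5 m A B C j g| ≤ 1 := by intro j g; fin_cases j <;> exact abs_tabZ_le _ _ _
    have hZ5 : ∀ j g, |Z5 m C j g| ≤ 1 := by intro j g; fin_cases j <;> exact abs_tabZ_le _ _ _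
    have h8 : ∀ j, |sgn5 j * pcoef3 (X5 m A B C j) (Y5 m A B C j) (Z5 m C j) k| ≤ |sgn5 j| * 8 ^ m := by
      intro j
      rw [abs_mul]
      exact mul_le_mul_of_nonneg_left (abs_pcoef3_le _ _ _ (hX j) (hY j) (hZ5 j) k) (abs_nonneg _)
    have hsum : |cubicCoef sgn5 (X5 m A B C) (Y5 m A B C) (Z5 m C) k| ≤ 6 * 8 ^ m := by
      unfold cubicCoef
      calc |∑ j : Fin 5, sgn5 j * pcoef3 (X5 m A B C j) (Y5 m A B C j) (Z5 m C j) k|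
          ≤ ∑ j : Fin 5, |sgn5 j * pcoef3 (X5 m A B C j) (Y5 m A B C j) (Z5 m C j) k| := Finset.abs_sum_le_sum_abs _ _
        _ ≤ ∑ j : Fin 5, |sgn5 j| * (8 : ℤ) ^ m := Finset.sum_le_sum fun j _ => h8 j
        _ = 6 * 8 ^ m := by simp [Fin.sum_univ_five, sgn5]; ring
    have hpow : (6 : ℤ) * 8 ^ m < (2 : ℕ) ^ (σ - 1) := by exact_mod_cast hbnd
    exact lt_of_le_of_lt hsum hpow
  set N : ℕ := (zE3 σ m (krT σ m (fullN m)) A B C + maskN σ (4 ^ m)).toNat with hN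
  have hNZ : (N : ℤ) = cubicZ (2 ^ σ) sgn5 (X5 m A B C) (Y5 m A B C) (Z5 m C) +
      ∑ j : Fin (4 ^ m), (2 : ℤ) ^ (σ - 1) * (2 ^ σ) ^ (j : ℕ) := by
    rw [hN, Int.toNat_of_nonneg hZ, hZeq, maskN_eq_sum σ hσ, Fin.sum_univ_eq_sum_range
      (fun j => (2 : ℤ) ^ (σ - 1) * (2 ^ σ) ^ j) (4 ^ m)]
  have hdig : ∀ j : ℕ, j < 4 ^ m → 2 ^ (σ - 1) ≤ digit (2 ^ σ) N j := digit_ge_of_land σ hσ (4 ^ m) N hland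
  exact cubicCoef_nonneg_of_digit_ge hσ hB N hNZ hdig

/-! ### `E₃` on the cube `Fin m` in the `box`/`bern` vocabulary -/

section FinCube

variable {m : ℕ}

/-- A degree-3 key as a profile. [this work] -/
def keyProf3 (k : Fin m → Fin 4) : Fin m → ℕ := fun i => (k i : ℕ)

/-- A profile as a degree-3 key (truncated at `3`). [this work] -/
def profKey3 (j : Fin m → ℕ) : Fin m → Fin 4 := fun i => ⟨min (j i) 3, by omega⟩

/-- Keys lie in the box `j ≤ 3`. [this work] -/
theorem keyProf3_mem_box (k : Fin m → Fin 4) : keyProf3 k ∈ box (fun _ : Fin m => 3) :=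
  mem_box.2 fun i => by have := (k i).2; simp only [keyProf3]; omega

/-- `profKey3 ∘ keyProf3 = id`. [this work] -/
theorem profKey3_keyProf3 (k : Fin m → Fin 4) : profKey3 (keyProf3 k) = k := by
  funext i; apply Fin.ext; have := (k i).2; simp only [profKey3, keyProf3]; omega

/-- `keyProf3 ∘ profKey3 = id` on the box. [this work] -/
theorem keyProf3_profKey3 {j : Fin m → ℕ} (hj : j ∈ box (fun _ : Fin m => 3)) : keyProf3 (profKey3 j) = j := by
  funext i; have := mem_box.1 hj i; simp only [profKey3, keyProf3]; omega

/-- The two degree-3 bases agree. [this work] -/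
theorem prod_bern4_eq_bern (p : Fin m → unitInterval) (k : Fin m → Fin 4) :
    ∏ i, bern4 (p i : ℝ) (k i) = bern (fun _ : Fin m => 3) (keyProf3 k) p := rfl

/-- **`E₃` of cube events is the five-term cubic form of their bitmask tables.** [this work] -/
theorem sahiE_three_ind_eq_cubicForm (p : Fin m → unitInterval) (A B C : Set (Set (Fin m))) :
    sahiE (bernoulliWeight p) 3 ![ind A, ind B, ind C] =
      cubicForm sgn5 (X5 m (encA m A) (encA m B) (encA m C)) (Y5 m (encA m A) (encA m B) (encA m C)) (Z5 m (encA m C))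
        (fun i => (p i : ℝ)) := by
  rw [sahiE_three_ind, sahiE3_def]
  have e : ∀ X : Set (Set (Fin m)), (prodBernoulli p).real X = ML (tabR m (encA m X)) (fun i => (p i : ℝ)) :=
    real_eq_ML_cube p
  rw [e, e, e, e, e, e, e]
  simp only [tabR_encA_inter, tabR_land]
  unfold cubicForm
  simp only [Fin.sum_univ_five, sgn5, X5, Y5, Z5, Matrix.cons_val_zero, Matrix.cons_val_one, Matrix.cons_val,
    tabZ_land]
  have h1 : ML (fun g => ((tabZ m (fullN m) g : ℤ) : ℝ)) (fun i => (p i : ℝ)) = 1 := ML_fullN m _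
  rw [h1]
  unfold tabR
  push_cast
  ring

/-- **The degree-3 expansion of `E₃` on `Fin m` with the certified coefficients**:
`E₃(μ_p; 1_A,1_B,1_C) = Σ_{j ≤ 3} cubicCoef(profKey3 j) · bern 3 j p`. [this work] -/
theorem sahiE_three_ind_bernstein_cube (p : Fin m → unitInterval) (A B C : Set (Set (Fin m))) :
    sahiE (bernoulliWeight p) 3 ![ind A, ind B, ind C] =
      ∑ j ∈ box (fun _ : Fin m => 3),
        (cubicCoef sgn5 (X5 m (encA m A) (encA m B) (encA m C)) (Y5 m (encA m A) (encA m B) (encA m C)) (Z5 m (encA m C))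
            (profKey3 j) : ℝ) * bern (fun _ : Fin m => 3) j p := by
  rw [sahiE_three_ind_eq_cubicForm, cubicForm_eq]
  refine sum_nbij' keyProf3 profKey3 (fun k _ => keyProf3_mem_box k) (fun j _ => mem_univ _) (fun k _ => profKey3_keyProf3 k)
    (fun j hj => keyProf3_profKey3 hj) (fun k _ => ?_)
  rw [profKey3_keyProf3, prod_bern4_eq_bern]

/-- **A passing `checkTriple` is a comb-positivity certificate of `E₃(1_A,1_B,1_C)`.** [this work] -/
theorem combPos_sahiE_three_of_checkTriple {σ : ℕ} {A B C : Set (Set (Fin m))}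
    (h : checkTriple σ m (encA m A) (encA m B) (encA m C) = true) :
    CombPos (fun _ : Fin m => 3) (fun p => sahiE (bernoulliWeight p) 3 ![ind A, ind B, ind C]) :=
  ⟨fun j => (cubicCoef sgn5 (X5 m (encA m A) (encA m B) (encA m C)) (Y5 m (encA m A) (encA m B) (encA m C)) (Z5 m (encA m C))
      (profKey3 j) : ℝ),
    fun j => by
      show (0 : ℝ) ≤ (cubicCoef sgn5 (X5 m (encA m A) (encA m B) (encA m C)) (Y5 m (encA m A) (encA m B) (encA m C))
        (Z5 m (encA m C)) (profKey3 j) : ℝ)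
      exact_mod_cast cubicCoef_nonneg_of_checkTriple h _,
    fun p => sahiE_three_ind_bernstein_cube p A B C⟩

/-- `E₃` is symmetric in its first two slots (every weight). [cite: LiebSahi2021, Def. 3.1 (symmetry of `E_n`)] -/
theorem sahiE_three_swap12 {α : Type*} [Fintype α] (μ : α → ℝ) (f g h : α → ℝ) :
    sahiE μ 3 ![f, g, h] = sahiE μ 3 ![g, f, h] := by
  rw [sahiE_three, sahiE_three, mul_comm f g, mul_comm g h, mul_comm f h]
  ring_nf

/-- `E₃` is symmetric in its last two slots (every weight). [cite: LiebSahi2021, Def. 3.1 (symmetry of `E_n`)] -/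
theorem sahiE_three_swap23 {α : Type*} [Fintype α] (μ : α → ℝ) (f g h : α → ℝ) :
    sahiE μ 3 ![f, g, h] = sahiE μ 3 ![f, h, g] := by
  rw [sahiE_three, sahiE_three, mul_comm g h, mul_right_comm f g h]
  ring_nf

/-- **A passing `checkCube m σ` certifies (M⁺-3) for every triple of increasing events of the cube `Fin m`.** [this work] -/
theorem combPos_sahiE_three_of_checkCube {σ : ℕ} (h : checkCube m σ = true) {A B C : Set (Set (Fin m))} (hA : IsUpperSet A)
    (hB : IsUpperSet B) (hC : IsUpperSet C) :
    CombPos (fun _ : Fin m => 3) (fun p => sahiE (bernoulliWeight p) 3 ![ind A, ind B, ind C]) := by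
  let P : {X : Set (Set (Fin m)) // IsUpperSet X} → {X : Set (Set (Fin m)) // IsUpperSet X} →
      {X : Set (Set (Fin m)) // IsUpperSet X} → Prop := fun a b c =>
    CombPos (fun _ : Fin m => 3) (fun p => sahiE (bernoulliWeight p) 3 ![ind a.1, ind b.1, ind c.1])
  have key : P ⟨A, hA⟩ ⟨B, hB⟩ ⟨C, hC⟩ := by
    refine forall_of_sorted P (fun a => encA m a.1) ?_ ?_ ?_ ⟨A, hA⟩ ⟨B, hB⟩ ⟨C, hC⟩
    · intro a b c habc
      exact habc.congr fun p => sahiE_three_swap12 _ _ _ _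
    · intro a b c habc
      exact habc.congr fun p => sahiE_three_swap23 _ _ _ _
    · intro a b c hab hbc
      exact combPos_sahiE_three_of_checkTriple (checkTriple_of_checkCube h (encA_mem_upsN a.2) (encA_mem_upsN b.2)
        (encA_mem_upsN c.2) hab hbc)
  exact key

/-- **(M⁺-3) on the cubes `Fin m`, `m ≤ 3`** (kernel-checked certificates `checkCube_zero … checkCube_three`). [this work] -/
theorem combPos_sahiE_three_cube_le_three (hm : m ≤ 3) {A B C : Set (Set (Fin m))} (hA : IsUpperSet A) (hB : IsUpperSet B)
    (hC : IsUpperSet C) : CombPos (fun _ : Fin m => 3) (fun p => sahiE (bernoulliWeight p) 3 ![ind A, ind B, ind C]) := by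
  interval_cases m
  · exact combPos_sahiE_three_of_checkCube checkCube_zero hA hB hC
  · exact combPos_sahiE_three_of_checkCube checkCube_one hA hB hC
  · exact combPos_sahiE_three_of_checkCube checkCube_two hA hB hC
  · exact combPos_sahiE_three_of_checkCube checkCube_three hA hB hC

end FinCube

/-! ### Transport to every small ground set; (★★) on small ground sets -/

/-- Relabelling: (M⁺-3) for a triple on `ι` from (M⁺-3) for its push-forward to `Fin (card ι)`. [this work] -/
theorem combPos_sahiE_three_of_fin {ι : Type} [Fintype ι] (U V W : Set (Set ι))
    (h : ∀ e : ι ≃ Fin (Fintype.card ι),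
      CombPos (fun _ : Fin (Fintype.card ι) => 3) (fun p' => sahiE (bernoulliWeight p') 3
        ![ind (ThreePartition.comapFam e.symm U), ind (ThreePartition.comapFam e.symm V), ind (ThreePartition.comapFam e.symm W)])) :
    CombPos (fun _ : ι => 3) (fun p => sahiE (bernoulliWeight p) 3 ![ind U, ind V, ind W]) := by
  obtain ⟨e⟩ : Nonempty (ι ≃ Fin (Fintype.card ι)) := ⟨Fintype.equivFin ι⟩
  have hcube : CombPos (fun _ : Fin (Fintype.card ι) => 3)
      (fun p' => sahiE (bernoulliWeight p') 3 (fun j => ind (ThreePartition.comapFam e.symm (![U, V, W] j)))) := by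
    refine (h e).congr fun p' => ?_
    congr 1; funext j; fin_cases j <;> rfl
  have ht := SahiC4CombBridge.CombPos.comp_equiv e hcube
  refine ht.congr fun p => ?_
  rw [SahiC4CombBridge.sahiE_bernoulliWeight_comap_equiv e p 3 ![U, V, W]]
  congr 1; funext j; fin_cases j <;> rfl

/-- **(M⁺-3) on every ground set with at most three elements**, every triple of increasing events. [this work] -/
theorem combPos_sahiE_three_of_card_le_three {ι : Type} [Fintype ι] (hι : Fintype.card ι ≤ 3) {U V W : Set (Set ι)}
    (hU : IsUpperSet U) (hV : IsUpperSet V) (hW : IsUpperSet W) :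
    CombPos (fun _ : ι => 3) (fun p => sahiE (bernoulliWeight p) 3 ![ind U, ind V, ind W]) :=
  combPos_sahiE_three_of_fin U V W fun e =>
    combPos_sahiE_three_cube_le_three hι (SahiC4CombBridge.isUpperSet_comapFam e hU)
      (SahiC4CombBridge.isUpperSet_comapFam e hV) (SahiC4CombBridge.isUpperSet_comapFam e hW)

/-- **(★★) on ground sets of size `≤ 3`, every twist**: `threePartNT τ 𝒰 𝒱 𝒲 ≥ 0` for all up-sets of a ground set with at most three
elements (bridge + kernel certificate). [this work] -/
theorem threePartNT_nonneg_of_card_le_three {ι : Type} [Fintype ι] (hι : Fintype.card ι ≤ 3) (τ : Set ι)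
    {U V W : Set (Set ι)} (hU : IsUpperSet U) (hV : IsUpperSet V) (hW : IsUpperSet W) :
    0 ≤ ThreePartition.threePartNT τ U V W :=
  ThreePartition.threePartNT_nonneg_of_combPos τ (combPos_sahiE_three_of_card_le_three hι hU hV hW)

end SahiC3CombCube

end Summit.CriticalPhenomena.PercolationContinuityZ3.Theorems
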